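import Literature.AlgebraicGeometry.Frobenioids.BirationalNormalizationExampleIsFrobenioid
import Literature.AlgebraicGeometry.Frobenioids.ModelFrobenioidComparison
import Literature.AlgebraicGeometry.Frobenioids.BiratLocalization
import HarnessLib

/-!
# Frobenioids I, Example 4.6: "if the `ξ_p ≠ 0`, then `C` fails to be of birationally
# Frobenius-normalized type" — PROVED (Frobenius-normalized ⇏ birationally Frobenius-normalized)

Mochizuki, *The geometry of Frobenioids I: the general theory*, Kyushu J. Math. **62** (2008)
293–400, kurims text pp. 86–87 [cite: MochizukiFrdI2008, Ex. 4.6 pp.86-87]: "it is not necessarily the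
case that a Frobenioid of Frobenius-normalized type is of birationally Frobenius-normalized type … if the
`ξ_p ≠ 0` [so `α_p` does not act on `M₀` by multiplication by `p`], then `C` fails to be of birationally
Frobenius-normalized type." PROOF-ONLY; sequel of `BirationalNormalizationExampleIsFrobenioid.lean` (seat
abc-iut-L1-t8: `Ex46.isFrobenioid`, `Ex46.isOfType_isFrobeniusNormalized`), over seat abc-iut-L6-t8's
birationalization `PreFrobenioid.Birat` / `toBirat` / `Birat.toElemGp` ([FrdI] Prop. 4.4 (i)) and Def. 4.5 (i)
as typed in `ModelFrobenioidComparison.lean` (`PreFrobenioid.IsBiratFrobeniusNormalized`).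

THE COMPUTATION (`Ex46.not_isBiratFrobeniusNormalized_A₀`): in `C^birat` let `φ = (0,0,0,n) ∈ End(A₀)` (base
identity, degree `n`) and `α = [(0,1,0,1) : A_{−1} → A₀ ; (0,0,1,1)] ∈ O^▷(A₀^birat)` (the element
`(0, −1, 1) ∈ M₀ = O^×(A₀^birat)`). Then `αⁿ = [(0,n,0,1) : A_{−n} → A₀ ; (0,0,n,1)]` (induction with the
squares `(0,k,0,1), (0,0,1,1)` out of `A_{−(k+1)}`), `φ ≫ αⁿ = [(0,1,0,1) ; (Ξ(n), 0, n, n)]` (square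
`(0,1,0,1), (Ξ(n),0,0,n)` out of `A_{−1}` — here the twist `α_n(0,1,0) = (Ξ(n), n, 0)` enters) and
`α ≫ φ = [(0,1,0,1) ; (0, 0, n, n)]`; equality of the classes would force (denominators are mono, refining
co-angular pre-steps are epi) `Ξ(n) = 0`. Hence `A₀` is NOT birationally Frobenius-normalized as soon as
`Ξ(n) = Σ_p v_p(n)(n/p) ξ_p ≠ 0` for some `n` (e.g. `n = p` with `ξ_p ≠ 0`), although every object of `C` is
Frobenius-normalized — a kernel-checked witness that Def. 4.5 (i) is strictly stronger than
Frobenius-normalization (the hypothesis of the author's 2024 Comments, item (29)(i), on Prop. 4.4 (ii)).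
Not here: `O^×(A^birat) = M₀`, rational type, Frobenius-compactness of `(C^un-tr)^birat` (Ex. 4.6's other
birational claims). No statement of the paper is strengthened; nothing here takes a side on [IUTchIII] Cor. 3.12.
-/

namespace Literature.AlgebraicGeometry.Frobenioids

open CategoryTheory Opposite

namespace Ex46

open PreFrobenioid

variable {G : Type} [AddCommGroup G] (P : Datum G)

/-- **Example 4.6: "if the `ξ_p ≠ 0`, then `C` fails to be of birationally Frobenius-normalized type"**
(FrdI p. 87) — PROVED in the form: if `Ξ(n) ≠ 0` for some `n ∈ N_{≥1}` (recall `Ξ(p) = ξ_p`), then the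
Frobenius-trivial object `A₀` is not birationally Frobenius-normalized (Def. 4.5 (i): its image in the
birationalization `C^birat` of Prop. 4.4 is not Frobenius-normalized). [cite: MochizukiFrdI2008, Ex. 4.6 p.87] -/
theorem not_isBiratFrobeniusNormalized_A₀ {n : ℕ+} (hn : P.Ξ n ≠ 0) :
    ¬ IsBiratFrobeniusNormalized (toElem P) (isFrobenioid P)
        (hasBiratSquares_of_isFrobenioid (isFrobenioid P)) (A₀ P) := by
  have hF : IsFrobenioid (toElem P) := isFrobenioid P
  have hsq : HasBiratSquares (toElem P) := hasBiratSquares_of_isFrobenioid hF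
  intro h
  change IsFrobeniusNormalized (Birat.toElemGp hF hsq) ((toBirat (toElem P) hF hsq).obj (A₀ P)) at h
  -- the Frobenius endomorphism `ζ = (0,0,0,n)` of `A₀` and its image `φ` in `C^birat`
  obtain ⟨ζ, hζ⟩ := exists_hom P (A₀ P) (A₀ P) 0 0 0 n le_rfl le_rfl (by show (0 : ℤ) - (n : ℤ) * 0 = 0 + 0; ring)
  let X₀ : Birat (toElem P) hF hsq := (toBirat (toElem P) hF hsq).obj (A₀ P)
  let φ : X₀ ⟶ X₀ := (toBirat (toElem P) hF hsq).map ζ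
  have hφb : IsBaseIdentity (Birat.toElemGp hF hsq) φ := Subsingleton.elim _ _
  have hφd : (degFr (Birat.toElemGp hF hsq) φ : ℕ) = n := by
    show ((val P ζ).d : ℕ) = n
    rw [hζ]
  -- the unit `α = [(0,1,0,1) : A_{-1} → A₀ ; (0,0,1,1)]` of `A₀^birat`
  let Am1 : Obj P := ⟨-1⟩
  obtain ⟨den, hden⟩ := exists_hom P Am1 (A₀ P) 0 1 0 1 zero_le_one le_rfl
    (by show (0 : ℤ) - (((1 : ℕ+) : ℕ) : ℤ) * (-1) = 1 + 0; simp)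
  obtain ⟨num, hnum⟩ := exists_hom P Am1 (A₀ P) 0 0 1 1 le_rfl zero_le_one
    (by show (0 : ℤ) - (((1 : ℕ+) : ℕ) : ℤ) * (-1) = 0 + 1; simp)
  have hden1 : IsCoAngularPreStep (toElem P) den := (isCoAngularPreStep_iff P den).mpr (by rw [hden])
  let fr : BiratFrac (toElem P) (A₀ P) (A₀ P) := ⟨Am1, den, num, hden1⟩
  let α : X₀ ⟶ X₀ := Birat.homMk (X := X₀) (Y := X₀) fr
  have hα : (show End X₀ from α) ∈ endSubmonoid (Birat.toElemGp hF hsq) X₀ :=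
    ⟨Subsingleton.elim _ _, show (val P num).d = 1 by rw [hnum]⟩
  have key := h φ hφb α hα
  rw [hφd] at key
  -- the powers `α^k = [(0,k,0,1) : A_{-k} → A₀ ; (0,0,k,1)]`
  have hpow : ∀ k : ℕ, ∃ (E : Obj P) (dk nk : E ⟶ A₀ P) (hdk : IsCoAngularPreStep (toElem P) dk),
      E.idx = -(k : ℤ) ∧ val P dk = ⟨(0, (k : ℤ), 0), 1⟩ ∧ val P nk = ⟨(0, 0, (k : ℤ)), 1⟩ ∧
        (show End X₀ from α) ^ k = (Birat.homMk (X := X₀) (Y := X₀) ⟨E, dk, nk, hdk⟩ : X₀ ⟶ X₀) := by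
    intro k
    induction k with
    | zero =>
      refine ⟨A₀ P, 𝟙 _, 𝟙 _, isCoAngularPreStep_id hF _, by show (0 : ℤ) = -((0 : ℕ) : ℤ); simp,
        by rw [Nat.cast_zero]; rfl, by rw [Nat.cast_zero]; rfl, ?_⟩
      rw [pow_zero]
      rfl
    | succ k ih =>
      obtain ⟨E, dk, nk, hdk, hE, hvd, hvn, hαk⟩ := ih
      let E' : Obj P := ⟨-((k : ℤ) + 1)⟩
      obtain ⟨left, hleft⟩ := exists_hom P E' Am1 0 k 0 1 (by positivity) le_rfl
        (by show (-1 : ℤ) - (((1 : ℕ+) : ℕ) : ℤ) * (-((k : ℤ) + 1)) = k + 0; simp)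
      obtain ⟨right, hright⟩ := exists_hom P E' E 0 0 1 1 le_rfl zero_le_one
        (by rw [hE]; show -(k : ℤ) - (((1 : ℕ+) : ℕ) : ℤ) * (-((k : ℤ) + 1)) = 0 + 1; simp)
      have hleft1 : IsCoAngularPreStep (toElem P) left := (isCoAngularPreStep_iff P left).mpr (by rw [hleft])
      have hw : left ≫ fr.num = right ≫ dk := by
        apply hom_ext P
        rw [val_comp, val_comp, hleft, hright, hvd]
        show val P num * _ = _
        rw [hnum]
        refine N.ext ?_ rfl
        simp only [N.mul_μ, Datum.α_apply, PNat.one_coe, Nat.cast_one, smul_zero, Datum.Ξ_one,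
          add_zero, mul_zero, mul_one, one_mul, Prod.mk_add_mk, zero_add]
      let S : BiratFrac.Square fr ⟨E, dk, nk, hdk⟩ := ⟨E', left, right, hleft1, hw⟩
      refine ⟨E', left ≫ den, right ≫ nk, hleft1.comp hF hden1, by simp [E'], ?_, ?_, ?_⟩
      · rw [val_comp, hden, hleft]
        refine N.ext ?_ rfl
        simp only [N.mul_μ, Datum.α_apply, PNat.one_coe, smul_zero, Datum.Ξ_one,
          add_zero, mul_zero, Prod.mk_add_mk, Nat.cast_succ]
        refine Prod.ext rfl (Prod.ext (by push_cast; ring) rfl)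
      · rw [val_comp, hvn, hright]
        refine N.ext ?_ rfl
        rw [N.mul_μ, Datum.α_apply]
        refine Prod.ext ?_ (Prod.ext ?_ ?_)
        · show (0 : G) + ((((1 : ℕ+) : ℕ) : ℤ) • (0 : G) + (0 : ℤ) • P.Ξ 1) = 0
          rw [smul_zero, zero_smul, add_zero, add_zero]
        · show (0 : ℤ) + (((1 : ℕ+) : ℕ) : ℤ) * 0 = 0
          rw [mul_zero, add_zero]
        · show (k : ℤ) + (((1 : ℕ+) : ℕ) : ℤ) * 1 = ((k + 1 : ℕ) : ℤ)
          push_cast; ring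
      · rw [pow_succ, End.mul_def, hαk]
        exact Birat.homMk_comp_homMk_eq (X := X₀) (Y := X₀) (Z := X₀) fr ⟨E, dk, nk, hdk⟩ S
  obtain ⟨E, dn, nn, hdn, hE, hvd, hvn, hαn⟩ := hpow n
  have key' : φ ≫ (Birat.homMk (X := X₀) (Y := X₀) ⟨E, dn, nn, hdn⟩ : X₀ ⟶ X₀) = α ≫ φ := by
    rw [← hαn]; exact key
  -- LHS: square `(0,1,0,1) : A_{-1} → A₀`, `(Ξ n, 0, 0, n) : A_{-1} → A_{-n}` for `((id, ζ), (dn, nn))`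
  obtain ⟨r₁, hr₁⟩ := exists_hom P Am1 E (P.Ξ n) 0 0 n le_rfl le_rfl
    (by rw [hE]; show -(n : ℤ) - (n : ℤ) * (-1) = 0 + 0; ring)
  have hw₁ : den ≫ (BiratFrac.ofHom hF ζ).num = r₁ ≫ dn := by
    apply hom_ext P
    show val P ζ * val P den = val P dn * val P r₁
    rw [hζ, hden, hvd, hr₁]
    refine N.ext ?_ (by rw [N.mul_d, N.mul_d]; exact (mul_one n).trans (one_mul n).symm)
    simp only [N.mul_μ, Datum.α_apply, PNat.one_coe, Nat.cast_one, one_smul, smul_zero, Datum.Ξ_one,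
      add_zero, mul_zero, mul_one, Prod.mk_add_mk, zero_add]
  let S₁ : BiratFrac.Square (BiratFrac.ofHom hF ζ) ⟨E, dn, nn, hdn⟩ := ⟨Am1, den, r₁, hden1, hw₁⟩
  have lhs : φ ≫ (Birat.homMk (X := X₀) (Y := X₀) ⟨E, dn, nn, hdn⟩ : X₀ ⟶ X₀) =
      Birat.homMk (X := X₀) (Y := X₀) (BiratFrac.compWith hF (BiratFrac.ofHom hF ζ) ⟨E, dn, nn, hdn⟩ S₁) :=
    Birat.homMk_comp_homMk_eq (X := X₀) (Y := X₀) (Z := X₀) _ _ S₁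
  -- RHS: trivial square for `((den, num), (id, ζ))`
  let S₂ : BiratFrac.Square fr (BiratFrac.ofHom hF ζ) :=
    ⟨Am1, 𝟙 _, num, isCoAngularPreStep_id hF _, by
      show 𝟙 Am1 ≫ num = num ≫ 𝟙 (A₀ P); rw [Category.id_comp, Category.comp_id]⟩
  have rhs : α ≫ φ = Birat.homMk (X := X₀) (Y := X₀) (BiratFrac.compWith hF fr (BiratFrac.ofHom hF ζ) S₂) :=
    Birat.homMk_comp_homMk_eq (X := X₀) (Y := X₀) (Z := X₀) _ _ S₂
  rw [lhs, rhs, Birat.homMk_eq_homMk_iff] at key'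
  obtain ⟨E₀, ε, ε', hε, -, h₁, h₂⟩ := key'
  -- `h₁ : ε ≫ (den ≫ id) = ε' ≫ (id ≫ den)`, `h₂ : ε ≫ (r₁ ≫ nn) = ε' ≫ (num ≫ ζ)`
  change ε ≫ r₁ ≫ nn = ε' ≫ num ≫ ζ at h₂
  have h₁' : ε ≫ den = ε' ≫ den :=
    calc ε ≫ den = ε ≫ den ≫ 𝟙 (A₀ P) := by rw [Category.comp_id]
      _ = ε' ≫ 𝟙 Am1 ≫ den := h₁
      _ = ε' ≫ den := congrArg (fun f : Am1 ⟶ A₀ P => ε' ≫ f) (Category.id_comp den)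
  haveI : Mono den := mono_of_d_eq_one P den (by rw [hden])
  have hεε : ε = ε' := (cancel_mono den).mp h₁'
  subst hεε
  haveI : Epi ε := epi P ε
  have h₃ : r₁ ≫ nn = num ≫ ζ := (cancel_epi ε).mp h₂
  have h₄ := congrArg (fun f : Am1 ⟶ A₀ P => (val P f).μ.1) h₃
  simp only [comp_g, hr₁, hnum, hζ, hvn, N.a, PNat.one_coe, Nat.cast_one, one_smul, zero_smul, add_zero,
    smul_zero, zero_add] at h₄
  exact hn h₄

/-- **Example 4.6, the headline**: for a datum with some `Ξ(n) ≠ 0` (e.g. some `ξ_p ≠ 0`), the Frobenioid `C` is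
of Frobenius-normalized type (every object is Frobenius-normalized, `Ex46.isOfType_isFrobeniusNormalized`)
but NOT of birationally Frobenius-normalized type (Def. 4.5 (i)): "it is not necessarily the case that a
Frobenioid of Frobenius-normalized type is of birationally Frobenius-normalized type" (FrdI p. 86).
[cite: MochizukiFrdI2008, Ex. 4.6 p.86] -/
theorem frobeniusNormalized_not_biratFrobeniusNormalized {n : ℕ+} (hn : P.Ξ n ≠ 0) :
    IsOfType (IsFrobeniusNormalized (toElem P)) ∧
      ¬ ∀ A : Obj P, IsBiratFrobeniusNormalized (toElem P) (isFrobenioid P)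
        (hasBiratSquares_of_isFrobenioid (isFrobenioid P)) A :=
  ⟨isOfType_isFrobeniusNormalized P, fun h => not_isBiratFrobeniusNormalized_A₀ P hn (h (A₀ P))⟩

end Ex46

end Literature.AlgebraicGeometry.Frobenioids
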